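import Literature.Combinatorics.SimpleGraph.ReducedDivisors
import HarnessLib

/-!
# The maximum principle for the graph Laplacian on integer-valued functions, and the principle
# of least action for reduced divisors (Baker–Shokrieh 2013, Lemma 6, Corollary 7, Lemma 14)

Source (held, read at the page; statements VERBATIM). M. Baker, F. Shokrieh, *Chip-firing games,
potential theory on graphs, and spanning trees*, J. Combin. Theory Ser. A 120 (2013) 164–182
[BakerShokrieh2013] (held text `paper:arxiv-1107.1313`, chunks p0006–p0007 and p0009), with
`ℳ(G) = Hom(V(G), ℤ)` and `Δ_v(f) = Σ_{vw ∈ E(G)} (f(v) − f(w))`. §3.4 «The maximum principle»: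
«**Lemma 6.** Let `f ∈ ℳ(G)`. Let `A_max` (resp. `A_min`) be the set of vertices where `f`
achieve its maximum (resp. minimum) value. Then (a) For `v ∈ A_max`, `Δ_v(f) ≥ outdeg_{A_max}(v)`.
(b) For `v ∈ A_min`, `Δ_v(f) ≤ −outdeg_{A_min}(v)`. *Proof.* For part (a) let `v ∈ A_max`. For an
edge `e = vw`, if `w ∈ A_max` then `f(v) = f(w)`, and if `w ∉ A_max` then `f(v) − f(w) ≥ 1`. Since
`Δ_v(f) = Σ_{{v,w} ∈ E(G)} (f(v) − f(w))`, the result follows. Part (b) follows from part (a) by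
replacing `f` with `−f`. One obtains the following well-known corollary: **Corollary 7 (Maximum
principle).** Suppose `f ∈ ℳ(G)` is nonconstant. Then `f` achieves its maximum (resp. minimum)
value at a vertex `v` for which `Δ_v(f) > 0` (resp. `Δ_v(f) < 0`).» §4: «**Lemma 14 (Principle
of least action).** Let `D` be a `q`-reduced divisor. Assume `E ∼ D` and write `D = E + Δ(f)`.
(a) If `E ∈ |D|_q`, then `f(v) ≤ f(q)` for all `v ∈ V(G)`. (b) If `E + Δ(g) ∈ |D|_q`, then
`f(v) − f(q) ≤ g(v) − g(q)` for all `v ∈ V(G)`. […] For (b), let `E′ = E + Δ(g)`. Then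
`D = E′ + Δ(f − g)` and part (a) gives `f(v) − g(v) ≤ f(q) − g(q)`.» Here
`|D|_q = {E ∼ D : E(v) ≥ 0 for all v ≠ q}`. (The graphs of the source are connected.)

## What is formalised (`Δ(f) = G.lapMatrix ℤ *ᵥ f`, `outdeg_A(v) = |N(v) \ A|`; Lemma 14 (a) is
## the tree's `ReducedDivisors.IsReduced.apply_le_apply_base`)

* **Lemma 6** `card_sdiff_le_lapMatrix_mulVec_apply` (a) and
  `lapMatrix_mulVec_apply_le_neg_card_sdiff` (b);
* **Corollary 7** `exists_max_lapMatrix_mulVec_pos`, `exists_min_lapMatrix_mulVec_neg`, and the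
  «well-known» consequence `lapMatrix_mulVec_eq_zero_iff_forall_eq` (on a connected graph the
  integer-valued harmonic functions are the constants);
* **Lemma 14 (b)** `IsReduced.sub_le_sub_of_nonneg`.

Theorems only; no `sorry`; no named facts.
-/

open Finset SimpleGraph Matrix
open Literature.Combinatorics.SimpleGraph.ChipFiring

namespace Literature.Combinatorics.SimpleGraph.BakerNorine

variable {V : Type*} [Fintype V] [DecidableEq V] {G : SimpleGraph V} [DecidableRel G.Adj]

/-! ### §1 Lemma 6 -/

section MaxPrinciple

/-- **Lemma 6 (a).** «For `v ∈ A_max`, `Δ_v(f) ≥ outdeg_{A_max}(v)`», `A_max = {w : f(w) = max f}`.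
[cite: BakerShokrieh2013, Lemma 6 (a)] -/
theorem card_sdiff_le_lapMatrix_mulVec_apply (f : V → ℤ) {v : V} (hv : ∀ w, f w ≤ f v) :
    (#(G.neighborFinset v \ univ.filter (fun w => f w = f v)) : ℤ) ≤ (G.lapMatrix ℤ *ᵥ f) v := by
  rw [lapMatrix_mulVec_apply_eq_sum_sub, ← Finset.sum_sdiff (Finset.inter_subset_left
    (s₁ := G.neighborFinset v) (s₂ := univ.filter fun w => f w = f v))]
  have h0 : ∑ w ∈ G.neighborFinset v ∩ univ.filter (fun w => f w = f v), (f v - f w) = 0 :=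
    Finset.sum_eq_zero fun w hw => by
      have h := (mem_filter.1 (mem_inter.1 hw).2).2
      rw [h, sub_self]
  rw [h0, add_zero, Finset.sdiff_inter_self_left]
  have h := Finset.card_nsmul_le_sum (G.neighborFinset v \ univ.filter fun w => f w = f v)
    (fun w => f v - f w) 1 fun w hw => by
      have h1 := hv w
      have h2 : f w ≠ f v := fun h => (mem_sdiff.1 hw).2 (mem_filter.2 ⟨mem_univ w, h⟩)
      show (1 : ℤ) ≤ f v - f w
      omega
  rwa [nsmul_eq_mul, mul_one] at h

/-- **Lemma 6 (b).** «For `v ∈ A_min`, `Δ_v(f) ≤ −outdeg_{A_min}(v)`» («by replacing `f` with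
`−f`»). [cite: BakerShokrieh2013, Lemma 6 (b)] -/
theorem lapMatrix_mulVec_apply_le_neg_card_sdiff (f : V → ℤ) {v : V} (hv : ∀ w, f v ≤ f w) :
    (G.lapMatrix ℤ *ᵥ f) v ≤ -#(G.neighborFinset v \ univ.filter (fun w => f w = f v)) := by
  have h := card_sdiff_le_lapMatrix_mulVec_apply (G := G) (-f) (v := v)
    (fun w => by simp only [Pi.neg_apply]; exact neg_le_neg (hv w))
  have hset : (univ.filter fun w => (-f) w = (-f) v) = univ.filter fun w => f w = f v := by
    ext w; simp only [mem_filter, mem_univ, true_and, Pi.neg_apply, neg_inj]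
  rw [hset, Matrix.mulVec_neg, Pi.neg_apply] at h
  omega

end MaxPrinciple

/-! ### §2 Corollary 7: the maximum principle -/

section Corollary

/-- **Corollary 7 (Maximum principle), maximum half.** «Suppose `f ∈ ℳ(G)` is nonconstant. Then
`f` achieves its maximum […] value at a vertex `v` for which `Δ_v(f) > 0`» (`G` connected).
[cite: BakerShokrieh2013, Corollary 7] -/
theorem exists_max_lapMatrix_mulVec_pos (hG : G.Connected) {f : V → ℤ} (hf : ∃ x y, f x ≠ f y) :
    ∃ v, (∀ w, f w ≤ f v) ∧ 0 < (G.lapMatrix ℤ *ᵥ f) v := by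
  classical
  obtain ⟨x, y, hxy⟩ := hf
  obtain ⟨a, -, ha⟩ := Finset.exists_max_image univ f ⟨x, mem_univ x⟩
  -- some vertex lies below the maximum
  obtain ⟨z, hz⟩ : ∃ z, f z ≠ f a := by
    by_contra h
    push Not at h
    exact hxy ((h x).trans (h y).symm)
  -- walk from `a` to `z`; its first exit from `A_max` is a maximum vertex with an outside neighbour
  obtain ⟨p⟩ := hG.preconnected a z
  obtain ⟨d, -, hd1, hd2⟩ := p.exists_boundary_dart {w | f w = f a} rfl hz
  have hd1' : f d.fst = f a := hd1
  refine ⟨d.fst, fun w => hd1'.symm ▸ ha w (mem_univ w), lt_of_lt_of_le ?_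
    (card_sdiff_le_lapMatrix_mulVec_apply f fun w => hd1'.symm ▸ ha w (mem_univ w))⟩
  have hmem : d.snd ∈ G.neighborFinset d.fst \ univ.filter (fun w => f w = f d.fst) :=
    mem_sdiff.2 ⟨(mem_neighborFinset G _ _).2 d.adj,
      fun h => hd2 ((mem_filter.1 h).2.trans hd1')⟩
  exact_mod_cast Finset.card_pos.2 ⟨_, hmem⟩

/-- **Corollary 7 (Maximum principle), minimum half.** «[…] (resp. minimum) value at a vertex `v`
for which […] `Δ_v(f) < 0`» (`G` connected). [cite: BakerShokrieh2013, Corollary 7] -/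
theorem exists_min_lapMatrix_mulVec_neg (hG : G.Connected) {f : V → ℤ} (hf : ∃ x y, f x ≠ f y) :
    ∃ v, (∀ w, f v ≤ f w) ∧ (G.lapMatrix ℤ *ᵥ f) v < 0 := by
  obtain ⟨x, y, hxy⟩ := hf
  obtain ⟨v, hv, hpos⟩ := exists_max_lapMatrix_mulVec_pos hG (f := -f)
    ⟨x, y, fun h => hxy (neg_inj.1 h)⟩
  refine ⟨v, fun w => by have := hv w; simp only [Pi.neg_apply] at this; omega, ?_⟩
  rw [Matrix.mulVec_neg, Pi.neg_apply] at hpos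
  omega

/-- The «well-known» consequence: on a connected graph an integer-valued function is harmonic
(`Δ(f) = 0`) iff it is constant. [cite: BakerShokrieh2013, Corollary 7] -/
theorem lapMatrix_mulVec_eq_zero_iff_forall_eq (hG : G.Connected) (f : V → ℤ) :
    G.lapMatrix ℤ *ᵥ f = 0 ↔ ∀ v w, f v = f w := by
  constructor
  · intro h
    by_contra hne
    push Not at hne
    obtain ⟨v, w, hvw⟩ := hne
    obtain ⟨u, -, hpos⟩ := exists_max_lapMatrix_mulVec_pos hG ⟨v, w, hvw⟩
    rw [h, Pi.zero_apply] at hpos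
    exact lt_irrefl _ hpos
  · intro h
    funext v
    rw [lapMatrix_mulVec_apply_eq_sum_sub, Pi.zero_apply]
    exact Finset.sum_eq_zero fun w _ => by rw [h v w, sub_self]

end Corollary

/-! ### §3 Lemma 14 (b): the principle of least action -/

section LeastAction

/-- **Lemma 14 (b) (Principle of least action).** «Let `D` be a `q`-reduced divisor. Assume
`E ∼ D` and write `D = E + Δ(f)`. […] (b) If `E + Δ(g) ∈ |D|_q`, then
`f(v) − f(q) ≤ g(v) − g(q)` for all `v ∈ V(G)`» (part (a) is `IsReduced.apply_le_apply_base`;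
here `E = D − Δ(f)`). [cite: BakerShokrieh2013, Lemma 14 (b)] -/
theorem IsReduced.sub_le_sub_of_nonneg {q : V} {D : V → ℤ} (hD : IsReduced G q D) (f g : V → ℤ)
    (hE : ∀ v, v ≠ q → 0 ≤ (D - G.lapMatrix ℤ *ᵥ f + G.lapMatrix ℤ *ᵥ g) v) (v : V) :
    f v - f q ≤ g v - g q := by
  have h := hD.apply_le_apply_base (f := f - g) (fun w hw => by
    rw [Matrix.mulVec_sub, ← sub_add]; exact hE w hw) v
  simp only [Pi.sub_apply] at h
  omega

end LeastAction

end Literature.Combinatorics.SimpleGraph.BakerNorine
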